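import Mathlib
import Summits.ResolutionOfSingularities.ResolutionOfSingularities.Theorems.HomologicalConductorPersistenceCyclicTransferFamily
import HarnessLib

/-!
# Crux `Persistence` (stmt-16484) / rung S-2 `PersistenceSurface` (stmt-19970) — the GENERAL CYCLIC (μ_d)
# TRANSFER lemma for stable annihilators along `U = V^σ`, `σ^d = 1` (chain W4.4b, seat res-L1-w44b-stub-4 gen 4)

[OURS · L1 w44b · Σ6 / C4 class] Nothing here is a statement of the manuscript under review (Hironaka 2017);
AI-written, weaker than expert review.  Supersedes in generality `…PersistenceInvolutionTransfer` (p510111, `d = 2`)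
and `…PersistenceCyclicTransfer` (p515107, `d = 3`), whose proofs expanded all cross terms by hand.

SETTING. `U → V` commutative rings, `σ : V →ₐ[U] V` with `σ ^ d = 1` whose fixed ring is the (injective) image
of `U`; `ω ∈ U` a `d`-th root of unity satisfying CHARACTER ORTHOGONALITY `∑_{i<d} ω^{m i} = 0` for `d ∤ m`
(e.g. a primitive `d`-th root of unity in a domain, `sum_pow_mul_eq_zero_of_isPrimitiveRoot`), and `d ∈ Uˣ`;
`τ` a `σ`-semilinear automorphism of a `V`-module `M` with `τ^[d] = id`, `j : N ↪ M` the `U`-module of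
`τ`-invariants.  This is the algebra of the cyclic quotient `Spec V → Spec V/μ_d = Spec U` (`d` invertible).

RESULTS.
* `exists_comp_eq_smul_id_fixed_of_isotypic` — the ISOTYPIC AVERAGING LEMMA (master form; the planner's
  «Veronese lemma T-V» of S2-BRIEF v1.2 at the free-factorisation level): a free `V`-factorisation
  `g ∘ f = c • id_M` with `σ c = ω^γ c` and a scalar `a` in the isotypic product ideal
  `𝔞_γ = ⋂_{j mod d} V_{[j]}·V_{[-γ-j]}` (for each `j`: `a = ∑_k b_k b'_k`, `σ b_k = ω^j b_k`, `σ b'_k = ω^l b'_k`,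
  `d ∣ j + l + γ`) give a free `U`-factorisation of `u • id_N` whenever `algebraMap u = a · c`.  For `γ = 0`
  (`c` invariant) `𝔞₀ = U ∩ ⋂_{j≠0} V_{[j]}V_{[-j]}` — «`ca(R^G) ⊇ 𝔞·(ca(R) ∩ R^G)`» once fed with MCM data.
* `exists_comp_eq_smul_id_fixed_of_cyclic` — the case `γ = 1`, `a = a₀⋯a_{d-2}` with `σ aᵢ = ω aᵢ`: the rule
  «`w ∈ s̲ann_V(M)` of character `ω` ⟹ `w^d ∈ s̲ann_U(M^τ)`» behind the KEPT first steps of the `E₁₂`, `Ẽ₈`, `Ẽ₇`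
  towers (memos SIGMA6-E12, SIGMA6b); CA-layer corollaries in part 3 (`…CyclicTransferStable`).

PROOF (isotypic decomposition, no case expansion).  Conjugates `f⁽ⁱ⁾ = σ_Fⁱ ∘ f ∘ τ^{-i}`,
`g⁽ⁱ⁾ = τⁱ ∘ g ∘ σ_F^{-i}` (`σ_F` = coordinatewise `σ` on `Vˢ`; `τ^{-i} = τ^{i(d-1)}`), so that
`g⁽ⁱ⁾ f⁽ⁱ⁾ = σⁱ(c) • id = ωⁱc • id`, `f⁽ⁱ⁺¹⁾ τ = σ_F f⁽ⁱ⁾`, `τ g⁽ⁱ⁾ = g⁽ⁱ⁺¹⁾ σ_F`.  Character components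
`F_j = ∑_i ω^{ij} f⁽ⁱ⁾`, `G_l = ∑_i ω^{il} g⁽ⁱ⁾` satisfy `F_j τ = ω^j σ_F F_j`, `ω^l τ G_l = G_l σ_F`; hence with
`a = ∑_k b_{j,k} b'_{j,k}` (characters `ω^j`, `ω^{l_j}`, `j + l_j + γ ≡ 0`) the pairs
`(b_{j,k} F_j, b'_{j,k} G_{l_j})` are EQUIVARIANT, and by orthogonality
`∑_{j,k} b'_{j,k} G_{l_j} b_{j,k} F_j = a ∑_{i,i'} (∑_j ω^{i l_j + i'j}) g⁽ⁱ⁾f⁽ⁱ'⁾ = a·d ∑_i ω^{-iγ} g⁽ⁱ⁾f⁽ⁱ⁾ = d² a c • id`.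
Equivariant pairs restrict to the invariants through `(Vˢ)^σ = Uˢ`
(`exists_comp_eq_smul_id_fixed_of_equivariant_family`, part 1 = `…PersistenceCyclicTransferFamily`); divide by `d² ∈ Uˣ`.

DIMENSION CAVEAT (answer to CHAIN Q13-3, recorded here because it decides what the lemma can be used for): the
lemma is dimension-free; its INPUT in a `ca`-computation — «every high-syzygy `U`-module is `M^τ` for a `V`-module
`M` on which `c` is stably zero» — is Auslander's reflexive correspondence in dimension `2` and FAILS in dimension
`3` (K-C3: `V = k[a,b,c]` regular, `a ∈ ca V`, `a⁶ ∉ ca(V^{μ₆})`).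

References: Iyengar–Takahashi, IMRN 2016, arXiv:1404.1476, Remark 2.13 (stable annihilation)
[`IyengarTakahashi2014`]; the isotypic split is the Reynolds/character projector for `μ_d` (folklore).
-/

-- single-problem summit: the doubled namespace component `ResolutionOfSingularities` is forced
set_option linter.dupNamespace false

noncomputable section

open CategoryTheory Literature.RingTheory.CohomologyAnnihilator
open Summit.ResolutionOfSingularities.ResolutionOfSingularities.Theorems.NoZeno.SandwichCluster
open Summit.ResolutionOfSingularities.ResolutionOfSingularities.Theorems.HomologicalConductor.PersistenceSurfaceHullCover
open Summit.ResolutionOfSingularities.ResolutionOfSingularities.Theorems.HomologicalConductor.PersistenceInvolutionTransfer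
open Summit.ResolutionOfSingularities.ResolutionOfSingularities.Theorems.HomologicalConductor.PersistenceCyclicTransfer
open Summit.ResolutionOfSingularities.ResolutionOfSingularities.Theorems.HomologicalConductor.PersistenceCyclicTransferFamily

universe u

namespace Summit.ResolutionOfSingularities.ResolutionOfSingularities.Theorems.HomologicalConductor.PersistenceCyclicTransferGeneral

variable {U V : Type u} [CommRing U] [CommRing V] [Algebra U V]
variable {M : Type u} [AddCommGroup M] [Module V M] [Module U M] [IsScalarTower U V M]
variable {N : Type u} [AddCommGroup N] [Module U N]

/-! ## Families indexed by a finite type -/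

/-- The core restriction lemma of part 1 for a family of equivariant pairs indexed by any finite type
(reindex along `Fintype.equivFin`). [folklore] -/
theorem exists_comp_eq_smul_id_fixed_of_equivariant_fintype (σ : V →ₐ[U] V)
    (hfix : ∀ v : V, σ v = v → ∃ u : U, algebraMap U V u = v) (hinj : Function.Injective (algebraMap U V))
    (τ : M →+ M) (j : N →ₗ[U] M) (hjinj : Function.Injective j) (hjτ : ∀ n, τ (j n) = j n)
    (hjsurj : ∀ m, τ m = m → ∃ n, j n = m) {ι : Type*} [Fintype ι] {s : ℕ} (P : ι → (M →ₗ[V] (Fin s → V)))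
    (Q : ι → ((Fin s → V) →ₗ[V] M)) (hP : ∀ k m i, P k (τ m) i = σ (P k m i))
    (hQ : ∀ k x, τ (Q k x) = Q k (fun i => σ (x i))) {w : V} (hsum : ∀ m, ∑ k, Q k (P k m) = w • m)
    (u : U) (hu : algebraMap U V u = w) :
    ∃ (t : ℕ) (f' : N →ₗ[U] (Fin t → U)) (g' : (Fin t → U) →ₗ[U] N), g' ∘ₗ f' = u • LinearMap.id := by
  classical
  refine exists_comp_eq_smul_id_fixed_of_equivariant_family σ hfix hinj τ j hjinj hjτ hjsurj
    (fun k => P ((Fintype.equivFin ι).symm k)) (fun k => Q ((Fintype.equivFin ι).symm k)) (fun k => hP _)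
    (fun k => hQ _) (w := w) (fun m => ?_) u hu
  rw [← hsum m]
  exact Equiv.sum_comp (Fintype.equivFin ι).symm (fun k => Q k (P k m))

/-! ## The μ_d character split: the ISOTYPIC AVERAGING LEMMA -/

/-- **Isotypic averaging lemma (master form of the μ_d transfer; the planner's «Veronese lemma T-V», S2-BRIEF
v1.2).**  `σ ^ d = 1` on `V` with fixed ring `U`, `ω ∈ U` a `d`-th root of unity with character orthogonality,
`d ∈ Uˣ`; `τ` `σ`-semilinear with `τ^[d] = id`, `N = M^τ`.  Let `c` have character `ω^{γ}` (`σ c = ω^γ c`) and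
admit a free `V`-factorisation `g ∘ f = c • id_M`, and let `a ∈ V` lie in the ISOTYPIC PRODUCT IDEAL
`𝔞_γ = ⋂_{j mod d} V_{[j]}·V_{[-γ-j]}`, i.e. for every `j < d`, `a = ∑_k b_k b'_k` with `σ b_k = ω^j b_k`,
`σ b'_k = ω^{l} b'_k`, `d ∣ j + l + γ`.  Then `u • id_N` has a free `U`-factorisation whenever `algebraMap u = a c`.
(`γ = 0`: `𝔞₀ = ⋂_{j ≠ 0} V_{[j]}V_{[-j]}` — T-V; `γ = 1`, `a = a₀⋯a_{d-2}` with `σ aᵢ = ω aᵢ` — the cyclic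
transfer `exists_comp_eq_smul_id_fixed_of_cyclic`.) [folklore] -/
theorem exists_comp_eq_smul_id_fixed_of_isotypic (σ : V →ₐ[U] V) {d : ℕ} (hd : 0 < d) (hσd : σ ^ d = 1)
    (hfix : ∀ v : V, σ v = v → ∃ u : U, algebraMap U V u = v) (hinj : Function.Injective (algebraMap U V))
    (ω : U) (hωd : ω ^ d = 1) (horth : ∀ m : ℕ, ¬ d ∣ m → ∑ i ∈ Finset.range d, ω ^ (m * i) = 0)
    (hdU : IsUnit ((d : ℕ) : U)) (τ : M →+ M) (hτ : ∀ (v : V) (m : M), τ (v • m) = σ v • τ m)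
    (hτd : ∀ m, (⇑τ)^[d] m = m) (j : N →ₗ[U] M) (hjinj : Function.Injective j) (hjτ : ∀ n, τ (j n) = j n)
    (hjsurj : ∀ m, τ m = m → ∃ n, j n = m) {c : V} (gc : ℕ) (hc : σ c = algebraMap U V ω ^ gc * c) {a : V}
    (ha : ∀ j' : Fin d, ∃ (n : ℕ) (b b' : Fin n → V) (l : ℕ), (∀ k, σ (b k) = algebraMap U V ω ^ (j' : ℕ) * b k) ∧
      (∀ k, σ (b' k) = algebraMap U V ω ^ l * b' k) ∧ d ∣ (j' : ℕ) + l + gc ∧ ∑ k, b k * b' k = a)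
    {s : ℕ} (f : M →ₗ[V] (Fin s → V)) (g : (Fin s → V) →ₗ[V] M) (hgf : g ∘ₗ f = c • LinearMap.id) (u : U)
    (hu : algebraMap U V u = a * c) :
    ∃ (t : ℕ) (f' : N →ₗ[U] (Fin t → U)) (g' : (Fin t → U) →ₗ[U] N), g' ∘ₗ f' = u • LinearMap.id := by
  -- write `d = e + 1`
  obtain ⟨e, rfl⟩ : ∃ e, d = e + 1 := ⟨d - 1, by omega⟩
  -- the root of unity in `V`
  set η : V := algebraMap U V ω with hηdef
  have hσnη : ∀ n, (σ ^ n) η = η := fun n => AlgHom.commutes (σ ^ n) ω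
  have hηd : η ^ (e + 1) = 1 := by rw [hηdef, ← map_pow, hωd, map_one]
  have hηmod : ∀ p q : ℕ, η ^ (p + q * (e + 1)) = η ^ p := fun p q => by
    rw [pow_add, mul_comm q, pow_mul, hηd, one_pow, mul_one]
  have horthV : ∀ m : ℕ, ¬ (e + 1) ∣ m → ∑ i ∈ Finset.range (e + 1), η ^ (m * i) = 0 := fun m hm => by
    have := congrArg (algebraMap U V) (horth m hm)
    simpa [hηdef, map_sum, map_pow] using this
  have hsumV : ∀ m : ℕ, (e + 1) ∣ m → ∑ i ∈ Finset.range (e + 1), η ^ (m * i) = (e + 1 : V) :=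
    fun m hm => by
    obtain ⟨q, rfl⟩ := hm
    have : ∀ i, η ^ ((e + 1) * q * i) = 1 := fun i => by
      rw [mul_assoc, pow_mul, hηd, one_pow]
    simp [this]
  -- periodicity of `σ`-powers and `τ`-iterates
  have hσper : ∀ n q, σ ^ (n + q * (e + 1)) = σ ^ n := fun n q => by
    rw [pow_add, mul_comm, pow_mul, hσd, one_pow, mul_one]
  have hτper : ∀ n q m, (⇑τ)^[n + q * (e + 1)] m = (⇑τ)^[n] m := fun n q m =>
    iterate_add_mul_period τ hτd n q m
  have hτmul : ∀ q m, (⇑τ)^[q * (e + 1)] m = m := fun q m => by simpa using hτper 0 q m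
  have hτsl : ∀ n v m, (⇑τ)^[n] (v • m) = (σ ^ n) v • (⇑τ)^[n] m := iterate_map_smul_semilinear σ τ hτ
  have hc' : σ c = algebraMap U V (ω ^ gc) * c := by rw [map_pow]; exact hc
  have hσc : ∀ n, (σ ^ n) c = η ^ (gc * n) * c := fun n => by
    rw [pow_apply_eq_pow_mul σ (ω ^ gc) hc' n, map_pow, ← pow_mul]
  have hgf' : ∀ m, g (f m) = c • m := fun m => by simpa using LinearMap.congr_fun hgf m
  -- coordinatewise powers of `σ` on the free module
  let sFn : ℕ → (Fin s → V) → (Fin s → V) := fun n x i => (σ ^ n) (x i)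
  have sFn_apply : ∀ n x i, sFn n x i = (σ ^ n) (x i) := fun _ _ _ => rfl
  have sFn_add : ∀ n x y, sFn n (x + y) = sFn n x + sFn n y := fun n x y => by
    funext i; simp [sFn]
  have sFn_smul : ∀ n (v : V) x, sFn n (v • x) = (σ ^ n) v • sFn n x := fun n v x => by
    funext i; simp [sFn]
  have sFn_sFn : ∀ n n' x, sFn n (sFn n' x) = sFn (n + n') x := fun n n' x => by
    funext i; simp only [sFn, pow_add, AlgHom.mul_apply]
  have sFn_mul : ∀ q x, sFn (q * (e + 1)) x = x := fun q x => by
    funext i; simp only [sFn]; rw [show q * (e + 1) = 0 + q * (e + 1) by ring, hσper, pow_zero,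
      AlgHom.one_apply]
  have sFn_one : ∀ x, sFn 1 x = fun i => σ (x i) := fun x => by funext i; simp [sFn]
  have sFn_sum : ∀ (ι : Finset ℕ) (x : ℕ → Fin s → V), sFn 1 (∑ i ∈ ι, x i) = ∑ i ∈ ι, sFn 1 (x i) :=
    fun ι x => by
    funext k
    simp only [sFn, Finset.sum_apply, map_sum]
  -- the conjugates `f⁽ⁿ⁾ = σ_Fⁿ ∘ f ∘ τ^{-n}`, `g⁽ⁿ⁾ = τⁿ ∘ g ∘ σ_F^{-n}` (`τ^{-n} = τ^{n e}`)
  let fC : ℕ → (M →ₗ[V] (Fin s → V)) := fun n =>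
    { toFun := fun m => sFn n (f ((⇑τ)^[n * e] m))
      map_add' := fun m m' => by rw [iterate_map_add, map_add, sFn_add]
      map_smul' := fun v m => by
        rw [hτsl, map_smul, sFn_smul, RingHom.id_apply, ← AlgHom.mul_apply, ← pow_add,
          show n + n * e = 0 + n * (e + 1) by ring, hσper, pow_zero, AlgHom.one_apply] }
  let gC : ℕ → ((Fin s → V) →ₗ[V] M) := fun n =>
    { toFun := fun x => (⇑τ)^[n] (g (sFn (n * e) x))
      map_add' := fun x y => by rw [sFn_add, map_add, iterate_map_add]
      map_smul' := fun v x => by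
        rw [sFn_smul, map_smul, hτsl, RingHom.id_apply, ← AlgHom.mul_apply, ← pow_add,
          show n + n * e = 0 + n * (e + 1) by ring, hσper, pow_zero, AlgHom.one_apply] }
  have fC_apply : ∀ n m, fC n m = sFn n (f ((⇑τ)^[n * e] m)) := fun _ _ => rfl
  have gC_apply : ∀ n x, gC n x = (⇑τ)^[n] (g (sFn (n * e) x)) := fun _ _ => rfl
  have sFn_per : ∀ n q x, sFn (n + q * (e + 1)) x = sFn n x := fun n q x => by
    funext i; simp only [sFn, hσper]
  have hση : σ η = η := AlgHom.commutes σ ω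
  -- (R0) periodicity of the conjugates
  have fC_per : ∀ n, fC (n + (e + 1)) = fC n := fun n => by
    apply LinearMap.ext
    intro m
    rw [fC_apply, fC_apply, show n + (e + 1) = n + 1 * (e + 1) by ring, sFn_per,
      show (n + 1 * (e + 1)) * e = n * e + e * (e + 1) by ring, hτper]
  have gC_per : ∀ n, gC (n + (e + 1)) = gC n := fun n => by
    apply LinearMap.ext
    intro x
    rw [gC_apply, gC_apply, show (n + (e + 1)) * e = n * e + e * (e + 1) by ring, sFn_per,
      show n + (e + 1) = n + 1 * (e + 1) by ring, hτper]
  have fC_zero : fC (e + 1) = fC 0 := by simpa using fC_per 0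
  have gC_zero : gC (e + 1) = gC 0 := by simpa using gC_per 0
  -- (R1) `f⁽ⁿ⁺¹⁾ τ = σ_F f⁽ⁿ⁾`
  have hR1 : ∀ n m, fC (n + 1) (τ m) = sFn 1 (fC n m) := by
    intro n m
    have h1 : (⇑τ)^[(n + 1) * e] (τ m) = (⇑τ)^[(n + 1) * e + 1] m := rfl
    rw [fC_apply, fC_apply, h1, show (n + 1) * e + 1 = n * e + 1 * (e + 1) by ring, hτper, sFn_sFn,
      Nat.add_comm 1 n]
  -- (R2) `τ g⁽ⁿ⁾ = g⁽ⁿ⁺¹⁾ σ_F`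
  have hR2 : ∀ n x, τ (gC n x) = gC (n + 1) (sFn 1 x) := by
    intro n x
    rw [gC_apply, gC_apply, sFn_sFn, show (n + 1) * e + 1 = n * e + 1 * (e + 1) by ring, sFn_per,
      Function.iterate_succ_apply']
  -- (R3) `g⁽ⁿ⁾ f⁽ⁿ⁾ = σⁿ(c) • id`
  have hR3 : ∀ n m, gC n (fC n m) = (η ^ (gc * n) * c) • m := by
    intro n m
    rw [gC_apply, fC_apply, sFn_sFn, show n * e + n = n * (e + 1) by ring, sFn_mul, hgf', hτsl, hσc,
      ← Function.iterate_add_apply, show n + n * e = n * (e + 1) by ring, hτmul]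
  -- the character components
  let F : ℕ → (M →ₗ[V] (Fin s → V)) := fun j => ∑ i ∈ Finset.range (e + 1), (η ^ (i * j)) • fC i
  let G : ℕ → ((Fin s → V) →ₗ[V] M) := fun l => ∑ i ∈ Finset.range (e + 1), (η ^ (i * l)) • gC i
  have F_apply : ∀ j m, F j m = ∑ i ∈ Finset.range (e + 1), η ^ (i * j) • fC i m := fun j m => by
    show (∑ i ∈ Finset.range (e + 1), (η ^ (i * j)) • fC i) m = _
    rw [LinearMap.sum_apply]
    rfl
  have G_apply : ∀ l x, G l x = ∑ i ∈ Finset.range (e + 1), η ^ (i * l) • gC i x := fun l x => by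
    show (∑ i ∈ Finset.range (e + 1), (η ^ (i * l)) • gC i) x = _
    rw [LinearMap.sum_apply]
    rfl
  -- (R5) `F_j τ = η^j σ_F F_j`
  have hR5 : ∀ j m, F j (τ m) = η ^ j • sFn 1 (F j m) := by
    intro j m
    rw [F_apply, F_apply]
    have hper : (fun i => η ^ (i * j) • fC i (τ m)) (e + 1) = (fun i => η ^ (i * j) • fC i (τ m)) 0 := by
      simp only [fC_zero, zero_mul, pow_zero, pow_mul, hηd, one_pow]
    rw [← sum_range_succ_shift (e + 1) (fun i => η ^ (i * j) • fC i (τ m)) hper, sFn_sum, Finset.smul_sum]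
    refine Finset.sum_congr rfl fun i _ => ?_
    rw [hR1 i m, sFn_smul, map_pow, hσnη, smul_smul, ← pow_add, show (i + 1) * j = j + i * j by ring]
  -- (R6) `η^l τ G_l = G_l σ_F`
  have hR6 : ∀ l x, η ^ l • τ (G l x) = G l (sFn 1 x) := by
    intro l x
    rw [G_apply, G_apply, map_sum, Finset.smul_sum]
    have hper : (fun i => η ^ (i * l) • gC i (sFn 1 x)) (e + 1) = (fun i => η ^ (i * l) • gC i (sFn 1 x)) 0 := by
      simp only [gC_zero, zero_mul, pow_zero, pow_mul, hηd, one_pow]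
    rw [← sum_range_succ_shift (e + 1) (fun i => η ^ (i * l) • gC i (sFn 1 x)) hper]
    refine Finset.sum_congr rfl fun i _ => ?_
    rw [hτ, map_pow, hση, hR2 i x, smul_smul, ← pow_add, show l + i * l = (i + 1) * l by ring]
  -- the isotypic decompositions of `a`
  choose nn b b' l hb hb' hdvd hab using ha
  -- the equivariant pairs `(b_{j,k} F_j, b'_{j,k} G_{l_j})`
  let ι := Σ j' : Fin (e + 1), Fin (nn j')
  let P : ι → (M →ₗ[V] (Fin s → V)) := fun q => b q.1 q.2 • F q.1
  let Q : ι → ((Fin s → V) →ₗ[V] M) := fun q => b' q.1 q.2 • G (l q.1)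
  have hP : ∀ q m i, P q (τ m) i = σ (P q m i) := by
    intro q m i
    simp only [P, LinearMap.smul_apply, Pi.smul_apply, smul_eq_mul, map_mul]
    rw [hR5, hb q.1 q.2, Pi.smul_apply, smul_eq_mul, sFn_apply, pow_one]
    ring
  have hQ : ∀ q x, τ (Q q x) = Q q (fun i => σ (x i)) := by
    intro q x
    simp only [Q, LinearMap.smul_apply]
    rw [hτ, hb' q.1 q.2, mul_comm, mul_smul, hR6, sFn_one]
  -- (R9) orthogonality: `η^{iγ} · (coefficient of g⁽ⁱ⁾ f⁽ⁱ'⁾ in ∑_j G_{l_j} F_j) = d [i = i']`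
  have hηunit : IsUnit η := IsUnit.of_pow_eq_one hηd (Nat.succ_ne_zero e)
  have hcoef : ∀ i ∈ Finset.range (e + 1), ∀ i' ∈ Finset.range (e + 1),
      η ^ (i * gc) * ∑ j' : Fin (e + 1), η ^ (i * l j') * η ^ (i' * (j' : ℕ)) =
        if i = i' then (e + 1 : V) else 0 := by
    intro i hi i' hi'
    rw [Finset.mem_range] at hi hi'
    have hterm : ∀ j' : Fin (e + 1),
        η ^ (i * gc) * (η ^ (i * l j') * η ^ (i' * (j' : ℕ))) = η ^ ((i' + e * i) * (j' : ℕ)) := by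
      intro j'
      obtain ⟨q, hq⟩ := hdvd j'
      have hq' : i * q * (e + 1) = i * ((j' : ℕ) + l j' + gc) := by rw [hq]; ring
      have hexp : i * gc + (i * l j' + i' * (j' : ℕ)) + (j' : ℕ) * i * (e + 1) =
          (i' + e * i) * (j' : ℕ) + i * q * (e + 1) := by
        rw [hq']; ring
      rw [← pow_add, ← pow_add, ← hηmod (i * gc + (i * l j' + i' * (j' : ℕ))) ((j' : ℕ) * i), hexp, hηmod]
    rw [Finset.mul_sum, Finset.sum_congr rfl fun j' _ => hterm j',
      Fin.sum_univ_eq_sum_range (fun j' => η ^ ((i' + e * i) * j')) (e + 1)]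
    by_cases h : i = i'
    · subst h
      rw [if_pos rfl, hsumV _ ((succ_dvd_add_mul_iff (by omega) (by omega)).mpr rfl)]
    · rw [if_neg h, horthV _ (fun hdvd' => h ((succ_dvd_add_mul_iff (by omega) (by omega)).mp hdvd'))]
  have hGF : ∀ l₀ j₀ m, G l₀ (F j₀ m) = ∑ i ∈ Finset.range (e + 1), ∑ i' ∈ Finset.range (e + 1),
      (η ^ (i * l₀) * η ^ (i' * j₀)) • gC i (fC i' m) := by
    intro l₀ j₀ m
    rw [G_apply]
    refine Finset.sum_congr rfl fun i _ => ?_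
    rw [F_apply, map_sum, Finset.smul_sum]
    refine Finset.sum_congr rfl fun i' _ => ?_
    rw [map_smul, smul_smul]
  have hS : ∀ m, ∑ j' : Fin (e + 1), G (l j') (F j' m) = ((e + 1 : V) * ((e + 1 : V) * c)) • m := by
    intro m
    -- the coefficient matrix
    set C : ℕ → ℕ → V := fun i i' => ∑ j' : Fin (e + 1), η ^ (i * l j') * η ^ (i' * (j' : ℕ)) with hCdef
    have hC0 : ∀ i ∈ Finset.range (e + 1), ∀ i' ∈ Finset.range (e + 1), i ≠ i' → C i i' = 0 := by
      intro i hi i' hi' hne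
      have h := hcoef i hi i' hi'
      rw [if_neg hne] at h
      exact ((hηunit.pow (i * gc)).mul_right_eq_zero).mp h
    have hCdiag : ∀ i ∈ Finset.range (e + 1), C i i * (η ^ (gc * i) * c) = (e + 1 : V) * c := by
      intro i hi
      have h := hcoef i hi i hi
      rw [if_pos rfl] at h
      rw [← mul_assoc, mul_comm (C i i), mul_comm gc i, h]
    calc ∑ j' : Fin (e + 1), G (l j') (F j' m)
        = ∑ j' : Fin (e + 1), ∑ i ∈ Finset.range (e + 1), ∑ i' ∈ Finset.range (e + 1),
            (η ^ (i * l j') * η ^ (i' * (j' : ℕ))) • gC i (fC i' m) := by simp only [hGF]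
      _ = ∑ i ∈ Finset.range (e + 1), ∑ i' ∈ Finset.range (e + 1), ∑ j' : Fin (e + 1),
            (η ^ (i * l j') * η ^ (i' * (j' : ℕ))) • gC i (fC i' m) := by
          rw [Finset.sum_comm]
          exact Finset.sum_congr rfl fun i _ => Finset.sum_comm
      _ = ∑ i ∈ Finset.range (e + 1), ∑ i' ∈ Finset.range (e + 1), C i i' • gC i (fC i' m) := by
          refine Finset.sum_congr rfl fun i _ => Finset.sum_congr rfl fun i' _ => ?_
          rw [← Finset.sum_smul]
      _ = ∑ i ∈ Finset.range (e + 1), C i i • gC i (fC i m) := by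
          refine Finset.sum_congr rfl fun i hi => ?_
          exact Finset.sum_eq_single_of_mem i hi fun i' hi' hne => by rw [hC0 i hi i' hi' (Ne.symm hne), zero_smul]
      _ = ∑ i ∈ Finset.range (e + 1), ((e + 1 : V) * c) • m := by
          refine Finset.sum_congr rfl fun i hi => ?_
          rw [hR3, smul_smul, hCdiag i hi]
      _ = ((e + 1 : V) * ((e + 1 : V) * c)) • m := by
          rw [Finset.sum_const, Finset.card_range, ← Nat.cast_smul_eq_nsmul V, smul_smul]
          push_cast
          ring_nf
  have hsum : ∀ m, ∑ q : ι, Q q (P q m) = (a * ((e + 1 : V) * ((e + 1 : V) * c))) • m := by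
    intro m
    have hq : ∀ q : ι, Q q (P q m) = (b q.1 q.2 * b' q.1 q.2) • G (l q.1) (F q.1 m) := fun q => by
      simp only [P, Q, LinearMap.smul_apply, map_smul, smul_smul]
    simp only [hq]
    rw [show (∑ q : ι, (b q.1 q.2 * b' q.1 q.2) • G (l q.1) (F q.1 m)) =
        ∑ j' : Fin (e + 1), ∑ k : Fin (nn j'), (b j' k * b' j' k) • G (l j') (F j' m) from
        Fintype.sum_sigma (fun q : ι => (b q.1 q.2 * b' q.1 q.2) • G (l q.1) (F q.1 m))]
    simp only [← Finset.sum_smul, hab]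
    rw [← Finset.smul_sum, hS m, smul_smul]
  -- restrict the equivariant family to the invariants and divide by `(e+1)² ∈ Uˣ`
  have hdU' : IsUnit ((e : U) + 1) := by simpa using hdU
  have hu' : algebraMap U V (((e : U) + 1) * ((e : U) + 1) * u) = a * ((e + 1 : V) * ((e + 1 : V) * c)) := by
    rw [map_mul, map_mul, hu]
    simp only [map_add, map_natCast, map_one]
    ring
  obtain ⟨t, f', g', h⟩ := exists_comp_eq_smul_id_fixed_of_equivariant_fintype σ hfix hinj τ j hjinj hjτ hjsurj
    P Q hP hQ hsum _ hu'
  obtain ⟨wu, hwu⟩ := hdU'.mul hdU'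
  refine ⟨t, (↑wu⁻¹ : U) • f', g', ?_⟩
  rw [LinearMap.comp_smul, h, smul_smul]
  congr 1
  rw [← hwu, Units.inv_mul_cancel_left]

/-! ## The cyclic transfer: `c · a₀ ⋯ a_{d-2}` with all characters `ω` -/

/-- **Cyclic (μ_d) transfer, free form** (the case `γ = 1`, `a = a₀⋯a_{d-2}` of the isotypic averaging lemma):
`σ c = ω c`, `σ aᵢ = ω aᵢ` (`i < d-1`), a free `V`-factorisation `g ∘ f = c • id_M` ⟹ a free `U`-factorisation
of `u • id_N` whenever `algebraMap U V u = c * ∏_{i<d-1} aᵢ` (for `j < d` split the product as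
`(a₀⋯a_{j-1})·(a_j⋯a_{d-2})`, characters `ω^j`, `ω^{d-1-j}`). [folklore] -/
theorem exists_comp_eq_smul_id_fixed_of_cyclic (σ : V →ₐ[U] V) {d : ℕ} (hd : 0 < d) (hσd : σ ^ d = 1)
    (hfix : ∀ v : V, σ v = v → ∃ u : U, algebraMap U V u = v) (hinj : Function.Injective (algebraMap U V))
    (ω : U) (hωd : ω ^ d = 1) (horth : ∀ m : ℕ, ¬ d ∣ m → ∑ i ∈ Finset.range d, ω ^ (m * i) = 0)
    (hdU : IsUnit ((d : ℕ) : U)) (τ : M →+ M) (hτ : ∀ (v : V) (m : M), τ (v • m) = σ v • τ m)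
    (hτd : ∀ m, (⇑τ)^[d] m = m) (j : N →ₗ[U] M) (hjinj : Function.Injective j) (hjτ : ∀ n, τ (j n) = j n)
    (hjsurj : ∀ m, τ m = m → ∃ n, j n = m) {c : V} (hc : σ c = algebraMap U V ω * c) (a : ℕ → V)
    (ha : ∀ i, i < d - 1 → σ (a i) = algebraMap U V ω * a i) {s : ℕ} (f : M →ₗ[V] (Fin s → V))
    (g : (Fin s → V) →ₗ[V] M) (hgf : g ∘ₗ f = c • LinearMap.id) (u : U)
    (hu : algebraMap U V u = c * ∏ i ∈ Finset.range (d - 1), a i) :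
    ∃ (t : ℕ) (f' : N →ₗ[U] (Fin t → U)) (g' : (Fin t → U) →ₗ[U] N), g' ∘ₗ f' = u • LinearMap.id := by
  obtain ⟨e, rfl⟩ : ∃ e, d = e + 1 := ⟨d - 1, by omega⟩
  simp only [Nat.add_sub_cancel] at ha hu
  set η : V := algebraMap U V ω with hηdef
  have hσeL : ∀ j', j' ≤ e → σ (∏ i ∈ Finset.range j', a i) = η ^ j' * ∏ i ∈ Finset.range j', a i := by
    intro j' hj
    rw [map_prod, Finset.prod_congr rfl fun i hi => ha i (lt_of_lt_of_le (Finset.mem_range.mp hi) hj),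
      Finset.prod_mul_distrib, Finset.prod_const, Finset.card_range]
  have hσeR : ∀ j', σ (∏ i ∈ Finset.Ico j' e, a i) = η ^ (e - j') * ∏ i ∈ Finset.Ico j' e, a i := by
    intro j'
    rw [map_prod, Finset.prod_congr rfl fun i hi => ha i (Finset.mem_Ico.mp hi).2, Finset.prod_mul_distrib,
      Finset.prod_const, Nat.card_Ico]
  refine exists_comp_eq_smul_id_fixed_of_isotypic σ (Nat.succ_pos e) hσd hfix hinj ω hωd horth hdU τ hτ hτd j
    hjinj hjτ hjsurj 1 (by rw [pow_one]; exact hc) (a := ∏ i ∈ Finset.range e, a i) (fun j' => ?_) f g hgf u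
    (by rw [hu, mul_comm])
  refine ⟨1, fun _ => ∏ i ∈ Finset.range (j' : ℕ), a i, fun _ => ∏ i ∈ Finset.Ico (j' : ℕ) e, a i, e - j',
    fun _ => hσeL j' j'.is_le, fun _ => hσeR j', ⟨1, by have := j'.is_le; omega⟩, ?_⟩
  rw [Fin.sum_univ_one, Finset.prod_range_mul_prod_Ico a j'.is_le]

end Summit.ResolutionOfSingularities.ResolutionOfSingularities.Theorems.HomologicalConductor.PersistenceCyclicTransferGeneral

end
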